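import Literature.NumberTheory.EllipticCurves.NewformGaloisRepModLOfNewformProofs
import Literature.NumberTheory.EllipticCurves.NewformGaloisRepDeligneOfThm61Proofs
import HarnessLib

/-!
# Deligne–Serre 1974, Thm. 6.7 in weight one from Deligne's theorem in the `ℓ`-adic carriers of
# `Ribet1977.thm21_exists_galoisRep` **at every place**

The tree states Deligne's theorem (Ribet 1977, Thm. (2.1); `NewformGaloisRepDeligneProofs`) as the
named fact `Ribet1977.thm21_exists_galoisRep`: for a newform `g` of weight `k ≥ 2` and a prime `ℓ`
there EXIST a finite extension `E/ℚ_ℓ` (module topology), `ι : K_g → E` and a continuous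
`ρ : Gal(ℚ̄/ℚ) → GL₂(E)` attached to `g` away from `M ℓ` (`IsGaloisRepOfNewform1 g ι {p ∣ M ℓ} ρ`).
As printed — "`ρ_ℓ : G → GL(2, K ⊗ Q_ℓ)`", whose `λ`-adic components are representations over
every `K_λ`, `λ ∣ ℓ` (LNM 601, p. 25); Deligne–Serre Thm. 6.1: "Soit `λ` une place finie de `K` …
Il existe alors une représentation … `ρ_λ : G → GL₂(K_λ)`"; Diamond–Shurman Thm. 9.6.5 — the
theorem holds for EVERY `(E, ι)`, and the proof of Deligne–Serre's Thm. 6.7 needs it at the place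
`λ` prescribed by `ι : 𝓞_f → 𝔽_ℓ`, not at an unspecified one.  This proofs-only file (theorems
only: no definition, no named fact; D-0026) proves the named fact `thm67_weightOne`
(`NewformGaloisRepModL`) from Thm. (2.1) in exactly the carriers of `thm21_exists_galoisRep` but
quantified over all `(E, ι)` (the binders of `Ribet1977.thm23_isIrreducible`):

* `thm67_weightOne_of_thm21_forall` — by `exists_newform_congr_of_weight_one` (Deligne–Serre
  6.8–6.11 and Atkin–Lehner–Li; `NewformGaloisRepModLOfNewformProofs`) there are a number field
  `K ⊆ ℂ`, a place `v` of `K` over `λ` and a newform `g₀` of weight `k' ≥ 2` with `K_{g₀} ⊆ K`,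
  congruent to `f` modulo `v`; apply the hypothesis to `E = K_v` — a finite extension of `ℚ_ℓ`
  with the module topology for its canonical `ℚ_ℓ`-algebra structure
  (`LocalField.adicCompletionPadicAlgebra`, `finiteDimensional_padic_adicCompletion`,
  `isModuleTopology_padic_adicCompletion` of `NewformGaloisRepDeligneOfThm61Proofs`) — and
  `ι = (K_{g₀} ⊆ K → K_v)`, and finish with 6.12–6.13 (`thm67_weightOne_core`).

Together with `Ribet1977.thm21_exists_galoisRep_of_thm61` (Thm. (2.1) from Thm. 6.1) this makes
the two printed shapes of Deligne's theorem interchangeable inputs of the weight-one theory.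

## References

* P. Deligne, J.-P. Serre, *Formes modulaires de poids 1*, Ann. Sci. ÉNS (4) 7 (1974), Thm. 6.1
  (p. 520), Thm. 6.7 and 6.8–6.13 (pp. 521–523). [DeligneSerreASENS1974]
* K. A. Ribet, *Galois representations attached to eigenforms with Nebentypus*, LNM 601 (1977),
  Thm. (2.1) (p. 25). [Ribet1977Nebentypus]
* F. Diamond, J. Shurman, *A first course in modular forms*, GTM 228 (2005), Thm. 9.6.5.
  [DiamondShurman2005]
-/

noncomputable section

open scoped MatrixGroups ModularForm NumberField Polynomial

open CongruenceSubgroup IsDedekindDomain Polynomial Rat.HeightOneSpectrum Field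

namespace Literature.NumberTheory.EllipticCurves.ModularForms.DeligneSerre1974

variable {N : ℕ} [NeZero N]

/-- **Deligne–Serre 1974, Thm. 6.7 in weight one (`thm67_weightOne`) from Deligne's theorem in
the `ℓ`-adic carriers of `Ribet1977.thm21_exists_galoisRep`, at every `(E, ι)`.**  Hypothesis
`h21` — Ribet 1977, Thm. (2.1) / Deligne 1971 / Deligne–Serre Thm. 6.1 for newforms, as printed
(every `λ ∣ ℓ`): for a newform `g ∈ S_k(Γ₁(M))`, `k ≥ 2`, a prime `ℓ`, every finite extension
`E/ℚ_ℓ` with its module topology and every `ι : K_g → E`, a continuous `ρ : Gal(ℚ̄/ℚ) → GL₂(E)`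
attached to `g` through `ι` away from `M ℓ` (`IsGaloisRepOfNewform1`: unramified at `p ∤ M ℓ`
with `det(X - ρ(Frob_p)) = ι(X² - a_p(g) X + ε_g(p) p^{k-1})`).  Conclusion: the named fact
`thm67_weightOne`.  Proof: `exists_newform_congr_of_weight_one` (6.8–6.11 with a newform `g₀`,
`K_{g₀} ⊆ K ⊆ ℂ`, a place `v` of `K` over `λ`), `h21` at `E = K_v` with its canonical
`ℚ_ℓ`-algebra structure (`LocalField.adicCompletionPadicAlgebra`; finite-dimensional with the
module topology) and `ι : K_{g₀} ⊆ K → K_v`, then 6.12–6.13 (`thm67_weightOne_core`) with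
Chebotarev, Lemme 6.13 and (2.7.2) discharged by the tree.
[cite: DeligneSerreASENS1974, Thm. 6.7 with Thm. 6.1 and 6.8–6.13] [cite: Ribet1977Nebentypus, Thm. (2.1) (LNM 601 p. 25)] -/
theorem thm67_weightOne_of_thm21_forall
    (h21 : ∀ {M : ℕ} [NeZero M] {k : ℤ} {g : CuspForm (Gamma1 M) k}, 2 ≤ k → IsNewform1 g →
      ∀ (ℓ : ℕ) [Fact ℓ.Prime] (E : Type) [Field E] [Algebra ℚ_[ℓ] E] [FiniteDimensional ℚ_[ℓ] E]
        [TopologicalSpace E] [IsModuleTopology ℚ_[ℓ] E] (ι : coeffCharField g →+* E),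
        ∃ ρ : GaloisRepresentations.FramedGaloisRep ℚ E 2,
          IsGaloisRepOfNewform1 g ι {p | p ∣ M * ℓ} ρ) :
    thm67_weightOne (N := N) := by
  intro f hf ℓ _ ι
  classical
  have hℓ : ℓ.Prime := Fact.out
  obtain ⟨K, _, i, v, k', M₀, _, hM₀, g₀, a, c, hK, -, hk', hℓk', hg₀, ha, hc, hker, haint,
    hacongr, hcp⟩ := exists_newform_congr_of_weight_one hf ℓ ι
  -- `ℓ ∈ v`
  have hℓv : ((ℓ : ℕ) : 𝓞 K) ∈ v.asIdeal := by
    have h1 := hker (ℓ : coeffCharIntegers f) (by rw [map_natCast, ZMod.natCast_self])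
    rw [show (((ℓ : coeffCharIntegers f) : coeffCharField f)) = (ℓ : coeffCharField f) by simp,
      map_natCast] at h1
    rw [← v.valuation_lt_one_iff_mem (K := K)]
    simpa using h1
  -- `E = K_v`, a finite extension of `ℚ_ℓ` with the module topology
  letI := GaloisRepresentations.LocalField.adicCompletionPadicAlgebra v ℓ hℓv
  haveI : FiniteDimensional ℚ_[ℓ] (v.adicCompletion K) :=
    finiteDimensional_padic_adicCompletion v ℓ hℓv
  haveI : IsModuleTopology ℚ_[ℓ] (v.adicCompletion K) :=
    isModuleTopology_padic_adicCompletion v ℓ hℓv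
  let ι₀ : coeffCharField g₀ →+* v.adicCompletion K :=
    (algebraMap K (v.adicCompletion K)).comp (IntermediateField.inclusion hK).toRingHom
  -- ### Thm. (2.1) at `(E, ι)`
  obtain ⟨ρ, hρ⟩ := h21 hk' hg₀ ℓ (v.adicCompletion K) ι₀
  -- ### 6.12–6.13
  refine thm67_weightOne_core
    (fun _ _ _ _ _ _ _ _ j φ _ hQ ↦
      Literature.RepresentationTheory.Semisimple.exists_descent_fin_two j φ hQ)
    LFunctions.Chebotarev.dirichletDensity_eq_holds
    (DeligneSerre1974_span_integralLattice1_holds N 1) hf ℓ ι i v hk' hℓk' a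
    (fun p ↦ c (p : ZMod M₀)) hker haint hacongr hcp ρ (fun w hw hwv ↦ ?_)
  set p : ℕ := ((primesEquiv w : Nat.Primes) : ℕ) with hpdef
  have hp : p.Prime := (primesEquiv w).2
  have hpS : p ∉ {p : ℕ | p ∣ M₀ * ℓ} := by
    intro h
    rcases (Nat.Prime.dvd_mul hp).mp h with h' | h'
    · exact hw (h'.trans (hM₀.trans (dvd_refl _)))
    · exact hw ((Nat.prime_dvd_prime_iff_eq hp hℓ).mp h' ▸ dvd_mul_left ℓ N)
  obtain ⟨hunr, hchar⟩ := hρ w hpS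
  refine ⟨hunr, ?_⟩
  -- the Hecke polynomial of `g₀` at `p`, through `ι₀`
  have h1 : (IntermediateField.inclusion hK)
      ⟨(UpperHalfPlane.qExpansion 1 ⇑g₀).coeff p, cuspCoeff_mem_coeffCharField g₀ p⟩ = a p :=
    Subtype.ext (by rw [ha]; rfl)
  have h2 : (IntermediateField.inclusion hK)
      ⟨(nebentypus g₀ (p : ZMod M₀) : ℂ) * (p : ℂ) ^ (k' - 1),
        nebentypus_mul_zpow_mem_coeffCharField g₀ p⟩ = c (p : ZMod M₀) * (p : K) ^ (k' - 1) := by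
    apply Subtype.ext
    have : ((c (p : ZMod M₀) * (p : K) ^ (k' - 1) : K) : ℂ) =
        (c (p : ZMod M₀) : ℂ) * (p : ℂ) ^ (k' - 1) := by
      push_cast
      rfl
    rw [this, hc]
    rfl
  have hpoly : (heckePolynomial g₀ p).map ι₀ =
      ((X ^ 2 - C (a p) * X + C (c (p : ZMod M₀) * (p : K) ^ (k' - 1))).map
        (algebraMap K (v.adicCompletion K))) := by
    rw [show ι₀ = (algebraMap K (v.adicCompletion K)).comp
        (IntermediateField.inclusion hK).toRingHom from rfl, ← Polynomial.map_map]
    congr 1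
    simp only [heckePolynomial, Polynomial.map_add, Polynomial.map_sub, Polynomial.map_mul,
      Polynomial.map_pow, Polynomial.map_X, Polynomial.map_C, AlgHom.toRingHom_eq_coe,
      RingHom.coe_coe, h1, h2]
  rw [← hpoly]
  exact hchar

end Literature.NumberTheory.EllipticCurves.ModularForms.DeligneSerre1974

end
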